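import Literature.Analysis.FunctionSpaces.TorusAxisStepCommutator
import HarnessLib

/-!
# The smoothed CUBE cut-off on `T^d` and its commutator with a Lipschitz function

Analysis/FunctionSpaces file (DEFINITIONS + proofs; no named facts).  The cube cut-off symbol
`cubeSym K Δ k = Πᵢ stepSym K Δ (kᵢ)` (`1` on the cube `‖k‖_∞ ≤ K`, `0` off `‖k‖_∞ ≤ K + 2Δ`, values in `[0,1]`, even;
carried by `cubeSupp d (K + 2Δ)`), its partial products `cubeSymOn T K Δ` over a set `T` of axes, and the COMMUTATOR BOUND
with a Lipschitz function in pairing form on real trigonometric polynomials: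

  `|∫ β ⟨h, χ P⟩ − ∫ β ⟨χ h, P⟩| ≤ (2dΛ/Δ) ‖h‖₂ ‖P‖₂`     (`abs_cubeSym_commutator_pairing_le`),

obtained by TELESCOPING the axes one at a time (`[AB, β] = A[B, β] + [A, β]B` with `A = Ψᵢ`, `B = χ_T`, both
`L²`-contractions on coefficients) through the one-axis bound `2Λ/Δ` of `TorusAxisStepCommutator`.  The point: the constant is
`d` times the one-dimensional first moment — there is no `log(K/Δ)` (which the `L¹` norm of the product KERNEL would cost) and no
Wiener norm of `β` (only its Lipschitz constant for the torus distance `‖reprc(x − y)‖`).  DiPerna–Lions, Invent. Math. 98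
(1989), §II.1 Lemma II.1 (commutator of a multiplier/mollifier with a Lipschitz field).

Consumer: cell `ad-ideate`, K1L_D `stmt-AnomalousDissipation-27980`, W3-E (ii) `stub_effectiveFrameEnergyL_bandKill`
(localised cube flux bound, descent ladder; finding F-k3l-7).

## Mathlib / tree search
Tree: `TorusAxisStepKernel` (`stepSym`), `TorusAxisStepCommutator` (`abs_axisStep_commutator_pairing_le`, `IsConjSymm.axisStep`),
`Torus.realTrigPoly`/`IsConjSymm`.  Mathlib: `Finset.induction_on`, `Fintype.piFinset`, `Real.sqrt_le_sqrt`.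

## References
* R. J. DiPerna, P.-L. Lions, Invent. Math. 98 (1989), §II.1 Lemma II.1. [`DiPernaLions1989`]
* L. Grafakos, *Classical Fourier Analysis*, 3rd ed., GTM 249 (2014), §3.1.3. [`Grafakos2014`]
-/

noncomputable section

open MeasureTheory Set Filter Complex UnitAddTorus Function Finset
open scoped ENNReal InnerProductSpace ComplexConjugate

namespace Literature.Analysis.FunctionSpaces

namespace Torus

variable {d : Type*} [Fintype d] [DecidableEq d]

/-! ## §8 The smoothed CUBE cut-off: product of the axis steps -/

section Cube

open EuclideanSpace

/-- **The smoothed cube symbol** `cubeSym K Δ k = Πᵢ stepSym K Δ (kᵢ)`: `1` on the cube `‖k‖_∞ ≤ K`, `0` off the cube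
`‖k‖_∞ ≤ K + 2Δ`, values in `[0,1]`, even. [cite: Grafakos2014, §3.1.3] -/
def cubeSym (K Δ : ℕ) (k : d → ℤ) : ℝ := ∏ i, stepSym K Δ (k i)

/-- The finite frequency set carrying the cube symbol: the cube `‖k‖_∞ ≤ K + 2Δ`. [cite: Grafakos2014, §3.1.3] -/
def cubeSupp (d : Type*) [Fintype d] [DecidableEq d] (R : ℕ) : Finset (d → ℤ) :=
  Fintype.piFinset fun _ : d => Finset.Icc (-(R : ℤ)) R

omit [DecidableEq d] in
/-- `0 ≤ cubeSym K Δ k`. [cite: Grafakos2014, §3.1.3] -/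
theorem cubeSym_nonneg (K Δ : ℕ) (k : d → ℤ) : 0 ≤ cubeSym K Δ k :=
  Finset.prod_nonneg fun i _ => stepSym_nonneg K Δ (k i)

omit [DecidableEq d] in
/-- `cubeSym K Δ k ≤ 1`. [cite: Grafakos2014, §3.1.3] -/
theorem cubeSym_le_one (K Δ : ℕ) (k : d → ℤ) : cubeSym K Δ k ≤ 1 :=
  Finset.prod_le_one (fun i _ => stepSym_nonneg K Δ (k i)) fun i _ => stepSym_le_one K Δ (k i)

omit [DecidableEq d] in
/-- `|cubeSym K Δ k| ≤ 1`. [cite: Grafakos2014, §3.1.3] -/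
theorem abs_cubeSym_le_one (K Δ : ℕ) (k : d → ℤ) : |cubeSym K Δ k| ≤ 1 := by
  rw [abs_of_nonneg (cubeSym_nonneg K Δ k)]; exact cubeSym_le_one K Δ k

omit [DecidableEq d] in
/-- The plateau: `cubeSym K Δ k = 1` when `|kᵢ| ≤ K` for all `i` (`Δ ≥ 1`). [cite: Grafakos2014, §3.1.3] -/
theorem cubeSym_eq_one {K Δ : ℕ} (hΔ : 0 < Δ) {k : d → ℤ} (hk : ∀ i, |k i| ≤ K) : cubeSym K Δ k = 1 :=
  Finset.prod_eq_one fun i _ => stepSym_eq_one hΔ (hk i)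

omit [DecidableEq d] in
/-- The support: `cubeSym K Δ k = 0` as soon as one coordinate has `K + 2Δ < |kᵢ|`. [cite: Grafakos2014, §3.1.3] -/
theorem cubeSym_eq_zero {K Δ : ℕ} {k : d → ℤ} {i : d} (hk : (K : ℤ) + 2 * Δ < |k i|) : cubeSym K Δ k = 0 :=
  Finset.prod_eq_zero (Finset.mem_univ i) (stepSym_eq_zero hk)

omit [DecidableEq d] in
/-- Parity: `cubeSym K Δ (−k) = cubeSym K Δ k`. [cite: Grafakos2014, §3.1.3] -/
theorem cubeSym_neg (K Δ : ℕ) (k : d → ℤ) : cubeSym K Δ (-k) = cubeSym K Δ k :=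
  Finset.prod_congr rfl fun i _ => by rw [Pi.neg_apply, stepSym_neg]

/-- Membership in the cube. [cite: Grafakos2014, §3.1.3] -/
theorem mem_cubeSupp {R : ℕ} {k : d → ℤ} : k ∈ cubeSupp d R ↔ ∀ i, |k i| ≤ R := by
  simp only [cubeSupp, Fintype.mem_piFinset, Finset.mem_Icc, abs_le]

/-- The cube is symmetric. [cite: Grafakos2014, §3.1.3] -/
theorem neg_mem_cubeSupp {R : ℕ} {k : d → ℤ} (hk : k ∈ cubeSupp d R) : -k ∈ cubeSupp d R := by
  rw [mem_cubeSupp] at hk ⊢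
  intro i; rw [Pi.neg_apply, abs_neg]; exact hk i

/-- Off the cube `‖k‖_∞ ≤ K + 2Δ` the cube symbol vanishes. [cite: Grafakos2014, §3.1.3] -/
theorem cubeSym_eq_zero_of_not_mem {K Δ : ℕ} {k : d → ℤ} (hk : k ∉ cubeSupp d (K + 2 * Δ)) : cubeSym K Δ k = 0 := by
  rw [mem_cubeSupp, not_forall] at hk
  obtain ⟨i, hi⟩ := hk
  rw [not_le] at hi
  exact cubeSym_eq_zero (i := i) (by push_cast at hi; exact hi)

omit [Fintype d] [DecidableEq d] in
/-- A real even weight preserves conjugate symmetry of coefficient families. [cite: Grafakos2014, §3.1.3] -/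
theorem IsConjSymm.real_weight [Fintype d] {c : (d → ℤ) → EuclideanSpace ℂ d} (hc : IsConjSymm c) {w : (d → ℤ) → ℝ}
    (hw : ∀ k, w (-k) = w k) : IsConjSymm (fun k => ((w k : ℝ) : ℂ) • c k) := by
  intro k
  show ((w (-k) : ℝ) : ℂ) • c (-k) = conjVec (((w k : ℝ) : ℂ) • c k)
  rw [hw, conjVec_smul, Complex.conj_ofReal, hc k]

omit [Fintype d] [DecidableEq d] in
/-- A weight of modulus `≤ 1` does not increase the `ℓ²` norm of a coefficient family. [cite: Grafakos2014, Prop. 3.2.7 (3)] -/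
theorem sum_norm_sq_weight_le [Fintype d] (S : Finset (d → ℤ)) (c : (d → ℤ) → EuclideanSpace ℂ d) {w : (d → ℤ) → ℝ}
    (hw : ∀ k, |w k| ≤ 1) : ∑ k ∈ S, ‖((w k : ℝ) : ℂ) • c k‖ ^ 2 ≤ ∑ k ∈ S, ‖c k‖ ^ 2 := by
  refine Finset.sum_le_sum fun k _ => ?_
  rw [norm_smul, Complex.norm_real, Real.norm_eq_abs]
  have h1 : |w k| * ‖c k‖ ≤ 1 * ‖c k‖ := mul_le_mul_of_nonneg_right (hw k) (norm_nonneg _)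
  rw [one_mul] at h1
  exact pow_le_pow_left₀ (by positivity) h1 2

/-- The partial cube symbol over a set `T` of axes. [cite: Grafakos2014, §3.1.3] -/
def cubeSymOn (T : Finset d) (K Δ : ℕ) (k : d → ℤ) : ℝ := ∏ i ∈ T, stepSym K Δ (k i)

omit [DecidableEq d] in
/-- `cubeSymOn univ = cubeSym`. [cite: Grafakos2014, §3.1.3] -/
theorem cubeSymOn_univ (K Δ : ℕ) (k : d → ℤ) : cubeSymOn Finset.univ K Δ k = cubeSym K Δ k := rfl

omit [Fintype d] [DecidableEq d] in
/-- `|cubeSymOn T K Δ k| ≤ 1`. [cite: Grafakos2014, §3.1.3] -/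
theorem abs_cubeSymOn_le_one (T : Finset d) (K Δ : ℕ) (k : d → ℤ) : |cubeSymOn T K Δ k| ≤ 1 := by
  unfold cubeSymOn
  rw [Finset.abs_prod]
  exact Finset.prod_le_one (fun i _ => abs_nonneg _) fun i _ => by
    rw [abs_of_nonneg (stepSym_nonneg _ _ _)]; exact stepSym_le_one _ _ _

omit [Fintype d] [DecidableEq d] in
/-- `cubeSymOn` is even. [cite: Grafakos2014, §3.1.3] -/
theorem cubeSymOn_neg (T : Finset d) (K Δ : ℕ) (k : d → ℤ) : cubeSymOn T K Δ (-k) = cubeSymOn T K Δ k :=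
  Finset.prod_congr rfl fun i _ => by rw [Pi.neg_apply, stepSym_neg]

omit [Fintype d] in
/-- Inserting an axis: `cubeSymOn (insert i T) = stepSym(kᵢ) · cubeSymOn T`. [cite: Grafakos2014, §3.1.3] -/
theorem cubeSymOn_insert {T : Finset d} {i : d} (hi : i ∉ T) (K Δ : ℕ) (k : d → ℤ) :
    cubeSymOn (insert i T) K Δ k = stepSym K Δ (k i) * cubeSymOn T K Δ k := by
  unfold cubeSymOn; rw [Finset.prod_insert hi]

/-- **THE COMMUTATOR OF THE CUBE CUT-OFF WITH A LIPSCHITZ FUNCTION** (pairing form, partial products): telescoping the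
axes one at a time through `abs_axisStep_commutator_pairing_le`,
`|∫ β ⟨h, χ_T P⟩ − ∫ β ⟨χ_T h, P⟩| ≤ (2 |T| Λ/Δ) ‖h‖₂ ‖P‖₂`. [cite: DiPernaLions1989, §II.1 Lemma II.1] -/
theorem abs_cubeSymOn_commutator_pairing_le (K : ℕ) {Δ : ℕ} (hΔ : 0 < Δ)
    {β : UnitAddTorus d → ℝ} (hβc : Continuous β) {Λ : ℝ} (hΛ : 0 ≤ Λ)
    (hβL : ∀ x y, |β x - β y| ≤ Λ * ‖reprc (x - y)‖)
    {S S' : Finset (d → ℤ)} (hS : ∀ k ∈ S, -k ∈ S) (hS' : ∀ k ∈ S', -k ∈ S') (T : Finset d) :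
    ∀ {c c' : (d → ℤ) → EuclideanSpace ℂ d}, IsConjSymm c → IsConjSymm c' →
    |(∫ x, β x * ⟪realTrigPoly S c x, realTrigPoly S' (fun k => ((cubeSymOn T K Δ k : ℝ) : ℂ) • c' k) x⟫_ℝ) -
      ∫ x, β x * ⟪realTrigPoly S (fun k => ((cubeSymOn T K Δ k : ℝ) : ℂ) • c k) x, realTrigPoly S' c' x⟫_ℝ| ≤
      2 * T.card * Λ / Δ * Real.sqrt (∑ k ∈ S, ‖c k‖ ^ 2) * Real.sqrt (∑ k ∈ S', ‖c' k‖ ^ 2) := by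
  induction T using Finset.induction_on with
  | empty =>
    intro c c' hc hc'
    have h1 : (fun k => ((cubeSymOn (∅ : Finset d) K Δ k : ℝ) : ℂ) • c' k) = c' := by
      funext k; simp [cubeSymOn]
    have h2 : (fun k => ((cubeSymOn (∅ : Finset d) K Δ k : ℝ) : ℂ) • c k) = c := by
      funext k; simp [cubeSymOn]
    rw [h1, h2, sub_self, abs_zero]
    simp
  | insert i T hi ih =>
    intro c c' hc hc'
    -- `χ_{T∪i} c' = σᵢ (χ_T c')` and `χ_{T∪i} c = χ_T (σᵢ c)`
    have e1 : (fun k => ((cubeSymOn (insert i T) K Δ k : ℝ) : ℂ) • c' k) =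
        fun k => ((stepSym K Δ (k i) : ℝ) : ℂ) • (((cubeSymOn T K Δ k : ℝ) : ℂ) • c' k) := by
      funext k; rw [cubeSymOn_insert hi, Complex.ofReal_mul, mul_smul]
    have e2 : (fun k => ((cubeSymOn (insert i T) K Δ k : ℝ) : ℂ) • c k) =
        fun k => ((cubeSymOn T K Δ k : ℝ) : ℂ) • (((stepSym K Δ (k i) : ℝ) : ℂ) • c k) := by
      funext k; rw [cubeSymOn_insert hi, Complex.ofReal_mul, mul_comm, mul_smul]
    rw [e1, e2]
    have hcT' : IsConjSymm (fun k => ((cubeSymOn T K Δ k : ℝ) : ℂ) • c' k) := hc'.real_weight (cubeSymOn_neg T K Δ)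
    have hci : IsConjSymm (fun k => ((stepSym K Δ (k i) : ℝ) : ℂ) • c k) := hc.axisStep K Δ i
    -- the axis commutator with `(c, χ_T c')` and the `T`-commutator with `(σᵢ c, c')`
    have hA := abs_axisStep_commutator_pairing_le i K hΔ hβc hΛ hβL hS hS' hc hcT'
    have hB := ih hci hc'
    -- norms of the weighted families
    have hn1 : Real.sqrt (∑ k ∈ S', ‖((cubeSymOn T K Δ k : ℝ) : ℂ) • c' k‖ ^ 2) ≤ Real.sqrt (∑ k ∈ S', ‖c' k‖ ^ 2) :=
      Real.sqrt_le_sqrt (sum_norm_sq_weight_le S' c' (abs_cubeSymOn_le_one T K Δ))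
    have hn2 : Real.sqrt (∑ k ∈ S, ‖((stepSym K Δ (k i) : ℝ) : ℂ) • c k‖ ^ 2) ≤ Real.sqrt (∑ k ∈ S, ‖c k‖ ^ 2) :=
      Real.sqrt_le_sqrt (sum_norm_sq_weight_le S c (fun k => by
        rw [abs_of_nonneg (stepSym_nonneg _ _ _)]; exact stepSym_le_one _ _ _))
    have h0 : 0 ≤ Real.sqrt (∑ k ∈ S, ‖c k‖ ^ 2) := Real.sqrt_nonneg _
    have h0' : 0 ≤ Real.sqrt (∑ k ∈ S', ‖c' k‖ ^ 2) := Real.sqrt_nonneg _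
    have hΔ0 : (0 : ℝ) < Δ := by exact_mod_cast hΔ
    rw [Finset.card_insert_of_notMem hi]
    push_cast
    calc _ ≤ |(∫ x, β x * ⟪realTrigPoly S c x, realTrigPoly S' (fun k => ((stepSym K Δ (k i) : ℝ) : ℂ) •
            (((cubeSymOn T K Δ k : ℝ) : ℂ) • c' k)) x⟫_ℝ) -
          ∫ x, β x * ⟪realTrigPoly S (fun k => ((stepSym K Δ (k i) : ℝ) : ℂ) • c k) x,
            realTrigPoly S' (fun k => ((cubeSymOn T K Δ k : ℝ) : ℂ) • c' k) x⟫_ℝ| +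
        |(∫ x, β x * ⟪realTrigPoly S (fun k => ((stepSym K Δ (k i) : ℝ) : ℂ) • c k) x,
            realTrigPoly S' (fun k => ((cubeSymOn T K Δ k : ℝ) : ℂ) • c' k) x⟫_ℝ) -
          ∫ x, β x * ⟪realTrigPoly S (fun k => ((cubeSymOn T K Δ k : ℝ) : ℂ) •
            (((stepSym K Δ (k i) : ℝ) : ℂ) • c k)) x, realTrigPoly S' c' x⟫_ℝ| := abs_sub_le _ _ _
      _ ≤ 2 * Λ / Δ * Real.sqrt (∑ k ∈ S, ‖c k‖ ^ 2) * Real.sqrt (∑ k ∈ S', ‖((cubeSymOn T K Δ k : ℝ) : ℂ) • c' k‖ ^ 2) +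
          2 * T.card * Λ / Δ * Real.sqrt (∑ k ∈ S, ‖((stepSym K Δ (k i) : ℝ) : ℂ) • c k‖ ^ 2) *
            Real.sqrt (∑ k ∈ S', ‖c' k‖ ^ 2) := add_le_add hA hB
      _ ≤ 2 * Λ / Δ * Real.sqrt (∑ k ∈ S, ‖c k‖ ^ 2) * Real.sqrt (∑ k ∈ S', ‖c' k‖ ^ 2) +
          2 * T.card * Λ / Δ * Real.sqrt (∑ k ∈ S, ‖c k‖ ^ 2) * Real.sqrt (∑ k ∈ S', ‖c' k‖ ^ 2) := by
          gcongr
      _ = 2 * ((T.card : ℝ) + 1) * Λ / Δ * Real.sqrt (∑ k ∈ S, ‖c k‖ ^ 2) * Real.sqrt (∑ k ∈ S', ‖c' k‖ ^ 2) := by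
          ring

/-- **THE COMMUTATOR OF THE FULL CUBE CUT-OFF** `χ = cubeSym K Δ` with a Lipschitz function:
`|∫ β ⟨h, χ P⟩ − ∫ β ⟨χ h, P⟩| ≤ (2dΛ/Δ) ‖h‖₂ ‖P‖₂`. [cite: DiPernaLions1989, §II.1 Lemma II.1] -/
theorem abs_cubeSym_commutator_pairing_le (K : ℕ) {Δ : ℕ} (hΔ : 0 < Δ)
    {β : UnitAddTorus d → ℝ} (hβc : Continuous β) {Λ : ℝ} (hΛ : 0 ≤ Λ)
    (hβL : ∀ x y, |β x - β y| ≤ Λ * ‖reprc (x - y)‖)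
    {S S' : Finset (d → ℤ)} (hS : ∀ k ∈ S, -k ∈ S) (hS' : ∀ k ∈ S', -k ∈ S')
    {c c' : (d → ℤ) → EuclideanSpace ℂ d} (hc : IsConjSymm c) (hc' : IsConjSymm c') :
    |(∫ x, β x * ⟪realTrigPoly S c x, realTrigPoly S' (fun k => ((cubeSym K Δ k : ℝ) : ℂ) • c' k) x⟫_ℝ) -
      ∫ x, β x * ⟪realTrigPoly S (fun k => ((cubeSym K Δ k : ℝ) : ℂ) • c k) x, realTrigPoly S' c' x⟫_ℝ| ≤
      2 * Fintype.card d * Λ / Δ * Real.sqrt (∑ k ∈ S, ‖c k‖ ^ 2) * Real.sqrt (∑ k ∈ S', ‖c' k‖ ^ 2) := by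
  have h := abs_cubeSymOn_commutator_pairing_le K hΔ hβc hΛ hβL hS hS' Finset.univ hc hc'
  simp only [cubeSymOn_univ, Finset.card_univ] at h
  exact h

end Cube


end Torus

end Literature.Analysis.FunctionSpaces

end
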